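import Summits.HodgeConjecture.HodgeConjecture.Theorems.F0P3cStCharTSRankOneHyp           -- ★ p849196 (this seat): `exists_roots_of_valued_lt_sq`
import Summits.HodgeConjecture.HodgeConjecture.Theorems.F0P3cStCharTSOffStratumG         -- ★ p849348 (this seat): §1 `valuation_eq_one_of_map_mul_self`, `map_mul_self_eq_one_of_mem_fin_one`
import Literature.NumberTheory.Rogawski1990.StableClassesSplitTorus                       -- ★ `isConj_of_isStablyConj_of_splitFrame_three`
import Literature.NumberTheory.Rogawski1990.LocalStableClassesNonsplitTypeOneOfCharpoly    -- ★ `exists_eigenframe_of_charpoly_eq_prod`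
import Literature.NumberTheory.Rogawski1990.UnitaryVertexStabilizerSpanCM                -- ★ `charpoly_conj_out_eq_of_delta_ne_zero`
import Literature.NumberTheory.Rogawski1990.LocalNormFibreSurjectiveNonsplit             -- ★ `coe_localNonsplitEquiv_eq_map`
import Literature.NumberTheory.Rogawski1990.LocalNormFibreNonsplit                       -- ★ `charpoly_endoEmbLocal`
import Literature.NumberTheory.Automorphic.UnitaryGroupInertPlaceHyperbolicBasis          -- ★ `galAdicCompletionMap_galAdicCompletionMap_of_smul_eq`
import HarnessLib

/-!
# F0 · P3c · line LH6 «StCharTS» — road (D) «DEEP-FL», brick D3-iv-b «ON THE STRATUM AT MOST ONE `G`-CLASS IS Δ-MATCHED»: for `γ_H` with `|det h₂|_w < |tr h₂|_w²`,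
# two classes `c, c′` of `G = U(Φ₃)(L⁺_v)` with `Δ(γ_H, c) ≠ 0 ≠ Δ(γ_H, c′)` coincide, so `Σ_c Δ(γ_H, c) Φ(c, f) = Δ(γ_H, c₀) Φ(c₀, f)`

Cell `pub/hodgecm-mathlib`, crux H413 = `stmt-HodgeConjecture-24833` (`--supports` lane, helper), route HCCMUnconditional; seat LH6-p04 (g2), road (D) owner;
status v3 `F0/P3b/LH6-p04/g2/ROAD-D.status.v3.txt` brick D3-iv (ON-stratum matching), part (b) `G`-side (twin of D3-iv-a `F0P3cStCharTSOnStratumH`).  THEOREMS ONLY,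
sorry-free.  HONEST LABEL: HC_CM is proved only modulo the 7 printed citations (2 remaining: hLiu418 = stmt-HodgeConjecture-24832, h413 = stmt-HodgeConjecture-24833)
until rung 0 closes; count-neutral.

THE MATHEMATICS («`𝔇(T∕F) = 1` for the maximally split torus `T ≅ E^× × E¹` of `U(3)`», [Rogawski1990, §3.6 p. 31]).  `Δ(γ_H, c) ≠ 0` forces (★ `charpoly_conj_out_eq_of_delta_ne_zero`,
★ `charpoly_endoEmbLocal`) `charpoly(E₃(out c)) = χ_{h₂}(X)·(X − u)` read at `w`; ON the stratum `χ_{h₂}` splits over `L_w` with roots `|l₁|_w > 1 > |l₂|_w` (★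
`exists_roots_of_valued_lt_sq`, `|det h₂|_w = 1`) and `|u|_w = 1`, so `E₃(out c)` has an eigenframe for the INJECTIVE diagonal `(l₁, u, l₂)` (★ `exists_eigenframe_of_charpoly_eq_prod`);
two such classes are `GL₃(L_w)`-conjugate, and the six norms `σ(dᵢ)dⱼ − 1` off the anti-diagonal are non-zero BY VALUATION, so ★ `isConj_of_isStablyConj_of_splitFrame_three`
conjugates them inside `U(Φ₃)(L_w)`; pulled back through the one-place model this is `c = c′` (§2), and the `Δ`-weighted sum of class orbital integrals has at most one term (§3).

## References
* [Rogawski1990] J. D. Rogawski, *Automorphic Representations of Unitary Groups in Three Variables*, Ann. of Math. Stud. 123 (1990), §3.1 p. 19; §3.6 p. 31; §4.3 (4.3.1) p. 43.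
* [Kottwitz1986] R. Kottwitz, *Stable trace formula: elliptic singular terms*, Math. Ann. 275 (1986), §7.
* [PlatonovRapinchuk1994] V. Platonov, A. Rapinchuk, *Algebraic Groups and Number Theory* (1994), §5.1 (the one-place model).
-/

set_option autoImplicit false
-- the mandated namespace has the single-problem summit's repeated segment (`HodgeConjecture.HodgeConjecture`)
set_option linter.dupNamespace false

noncomputable section

open Matrix Polynomial NumberField IsDedekindDomain
open scoped MatrixGroups
open Literature.NumberTheory.Rogawski1990 Literature.NumberTheory.Automorphic Literature.NumberTheory.Automorphic.UnitaryGroup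
open Literature.NumberTheory.GaloisRepresentations
open Literature.AlgebraicGeometry.ShimuraVarieties (unitaryGroup)

namespace Summit.HodgeConjecture.HodgeConjecture.Cruxes.H413.F0P3cStCharTSOnStratumG

/-! ## §1 Model level: same split separable charpoly + the split-torus norm pattern ⇒ one class (any field with involution) -/

section Model

variable {K : Type*} [Field K] (σ : K →+* K)

/-- `antidiag(1, 1, 1)` is `σ`-hermitian. [folklore] -/
theorem antidiagThree_map_transpose :
    ((Matrix.of fun i j : Fin 3 => if i.val + j.val + 1 = 3 then (1 : K) else 0).map σ)ᵀ =
      Matrix.of fun i j : Fin 3 => if i.val + j.val + 1 = 3 then (1 : K) else 0 := by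
  ext i j
  fin_cases i <;> fin_cases j <;> simp

/-- `det antidiag(1, 1, 1)` is a unit. [folklore] -/
theorem isUnit_det_antidiagThree : IsUnit (Matrix.of fun i j : Fin 3 => if i.val + j.val + 1 = 3 then (1 : K) else 0).det := by
  rw [Matrix.det_fin_three]
  simp

/-- `det g · σ(det g) = 1` for `g ∈ U(σ, J)` with `det J ≠ 0` (any size). [cite: Rogawski1990, §3.1 p. 19] -/
theorem det_mul_map_det_eq_one_of_mem_unitaryGroupOfForm {n : Type*} [Fintype n] [DecidableEq n] {J : Matrix n n K} (hJ : J.det ≠ 0)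
    {g : GL n K} (hg : g ∈ unitaryGroupOfForm σ J) : (g : Matrix n n K).det * σ (g : Matrix n n K).det = 1 := by
  rw [mem_unitaryGroupOfForm_iff] at hg
  have h := congrArg Matrix.det hg
  rw [Matrix.det_mul, Matrix.det_mul, Matrix.det_transpose, ← RingHom.mapMatrix_apply, ← RingHom.map_det] at h
  have h' : ((g : Matrix n n K).det * σ (g : Matrix n n K).det - 1) * J.det = 0 := by linear_combination h
  rcases mul_eq_zero.1 h' with h0 | h0
  · exact sub_eq_zero.1 h0
  · exact absurd h0 hJ

/-- An eigenframe exhibits `γ` as a conjugate of the diagonal: `γ = P · diag(d) · P⁻¹` in `GL`. [folklore] -/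
theorem coe_eq_of_eigenframe {m : ℕ} {γ P : GL (Fin m) K} {d : Fin m → K} (hP : γ.val * P.val = P.val * diagonal d) :
    γ.val = P.val * diagonal d * P⁻¹.val := by
  rw [← hP, Matrix.mul_assoc, Units.mul_inv, Matrix.mul_one]

/-- Two elements with eigenframes for the SAME diagonal are `GL`-conjugate: `(P′P⁻¹) γ (P′P⁻¹)⁻¹ = δ`. [folklore] -/
theorem conj_eq_of_eigenframes {m : ℕ} {γ δ P P' : GL (Fin m) K} {d : Fin m → K} (hP : γ.val * P.val = P.val * diagonal d)
    (hP' : δ.val * P'.val = P'.val * diagonal d) : P' * P⁻¹ * γ * (P' * P⁻¹)⁻¹ = δ := by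
  apply Units.ext
  simp only [Units.val_mul, _root_.mul_inv_rev, inv_inv]
  rw [coe_eq_of_eigenframe hP, coe_eq_of_eigenframe hP']
  calc P'.val * P⁻¹.val * (P.val * diagonal d * P⁻¹.val) * (P.val * P'⁻¹.val)
      = P'.val * (P⁻¹.val * P.val) * diagonal d * (P⁻¹.val * P.val) * P'⁻¹.val := by simp only [Matrix.mul_assoc]
    _ = P'.val * diagonal d * P'⁻¹.val := by rw [Units.inv_mul, Matrix.mul_one, Matrix.mul_one]

/-- **SAME SPLIT CHARPOLY + SPLIT-TORUS NORM PATTERN ⇒ ONE CLASS** in `U(σ, antidiag(1,1,1))(K)`: if `charpoly γ = charpoly δ = ∏ᵢ (X − dᵢ)` with `d` injective and the six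
norms `σ(dᵢ)dⱼ` (`(i,j) ∉ {(0,2),(1,1),(2,0)}`) are `≠ 1`, then `IsConj γ δ`. [cite: Rogawski1990, §3.6 p. 31] [cite: Kottwitz1986, §7] -/
theorem isConj_of_charpoly_eq_prod_of_splitPattern (hσ : ∀ r : K, σ (σ r) = r)
    {γ δ : unitaryGroup σ (Matrix.of fun i j : Fin 3 => if i.val + j.val + 1 = 3 then (1 : K) else 0)} {d : Fin 3 → K} (hd : Function.Injective d)
    (hγ : ((γ : GL (Fin 3) K) : Matrix (Fin 3) (Fin 3) K).charpoly = ∏ i, (X - C (d i)))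
    (hδ : ((δ : GL (Fin 3) K) : Matrix (Fin 3) (Fin 3) K).charpoly = ∏ i, (X - C (d i)))
    (h00 : σ (d 0) * d 0 ≠ 1) (h01 : σ (d 0) * d 1 ≠ 1) (h10 : σ (d 1) * d 0 ≠ 1)
    (h12 : σ (d 1) * d 2 ≠ 1) (h21 : σ (d 2) * d 1 ≠ 1) (h22 : σ (d 2) * d 2 ≠ 1) : IsConj γ δ := by
  obtain ⟨P, hP⟩ := exists_eigenframe_of_charpoly_eq_prod (γ : GL (Fin 3) K) d hd hγ
  obtain ⟨P', hP'⟩ := exists_eigenframe_of_charpoly_eq_prod (δ : GL (Fin 3) K) d hd hδ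
  have hst : IsStablyConj σ (Matrix.of fun i j : Fin 3 => if i.val + j.val + 1 = 3 then (1 : K) else 0) γ δ :=
    isStablyConj_iff.2 ⟨P' * P⁻¹, conj_eq_of_eigenframes hP hP'⟩
  have hu : ∀ {x : K}, x ≠ 1 → IsUnit (x - 1) := fun hx => by rw [isUnit_iff_ne_zero, sub_ne_zero]; exact hx
  exact isConj_of_isStablyConj_of_splitFrame_three σ _ hσ (antidiagThree_map_transpose σ) (isUnit_det_antidiagThree (K := K)) hst P hP
    (hu h00) (hu h01) (hu h10) (hu h12) (hu h21) (hu h22)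

end Model

/-! ## §2 Valuation bookkeeping for the diagonal `(l₁, u, l₂)` -/

section Val

variable {K : Type*} [Field K] {Γ₀ : Type*} [LinearOrderedCommGroupWithZero Γ₀] (v : Valuation K Γ₀)

/-- From `v(l₁ l₂) = 1` and `v(l₂) < v(l₁)`: `v(l₂) < 1 < v(l₁)`. [folklore] -/
theorem lt_one_lt_of_mul_eq_one_of_lt {l₁ l₂ : K} (h1 : v l₁ * v l₂ = 1) (hlt : v l₂ < v l₁) : v l₂ < 1 ∧ 1 < v l₁ := by
  have h10 : v l₁ ≠ 0 := fun h0 => by rw [h0, zero_mul] at h1; exact zero_ne_one h1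
  have h20 : v l₂ ≠ 0 := fun h0 => by rw [h0, mul_zero] at h1; exact zero_ne_one h1
  constructor
  · by_contra hle
    rw [not_lt] at hle
    have : (1 : Γ₀) < v l₁ * v l₂ := by
      calc (1 : Γ₀) ≤ v l₂ := hle
        _ = 1 * v l₂ := (one_mul _).symm
        _ ≤ v l₂ * v l₂ := mul_le_mul' hle le_rfl
        _ < v l₁ * v l₂ := mul_lt_mul_of_pos_right hlt (zero_lt_iff.2 h20)
    rw [h1] at this; exact lt_irrefl _ this
  · by_contra hle
    rw [not_lt] at hle
    have : v l₁ * v l₂ < 1 := by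
      calc v l₁ * v l₂ < v l₁ * v l₁ := mul_lt_mul_of_pos_left hlt (zero_lt_iff.2 h10)
        _ ≤ 1 * 1 := mul_le_mul' hle hle
        _ = 1 := one_mul _
    rw [h1] at this; exact lt_irrefl _ this

/-- The diagonal `(l₁, u, l₂)` with `v(l₂) < 1 = v(u) < v(l₁)` is injective. [folklore] -/
theorem injective_vecCons_three {l₁ u l₂ : K} (hu : v u = 1) (h2 : v l₂ < 1) (h1 : 1 < v l₁) : Function.Injective ![l₁, u, l₂] := by
  have h01 : l₁ ≠ u := fun h => by rw [h, hu] at h1; exact lt_irrefl _ h1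
  have h02 : l₁ ≠ l₂ := fun h => by rw [h] at h1; exact lt_irrefl _ (h1.trans h2)
  have h12 : u ≠ l₂ := fun h => by rw [h] at hu; rw [hu] at h2; exact lt_irrefl _ h2
  intro i j hij
  fin_cases i <;> fin_cases j
  all_goals (first | rfl | (exfalso; simp at hij; first | exact h01 hij | exact h01 hij.symm | exact h02 hij | exact h02 hij.symm | exact h12 hij | exact h12 hij.symm))

/-- `v(σ a · b) = v a · v b ≠ 1` bookkeeping: if `v(σ x) = v x` for all `x` and `v a · v b ≠ 1` then `σ a · b ≠ 1`. [folklore] -/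
theorem map_mul_ne_one_of_valuation (σ : K →+* K) (hσv : ∀ x, v (σ x) = v x) {a b : K} (h : v a * v b ≠ 1) : σ a * b ≠ 1 := by
  intro h1
  apply h
  have := congrArg v h1
  rwa [Valuation.map_mul, hσv, Valuation.map_one] at this

end Val

/-! ## §3 On the CM carriers: at most one Δ-matched class ON the stratum -/

section CM

variable (L : Type) [Field L] [NumberField L] [IsCMField L] (v : HeightOneSpectrum (𝓞 ↥(maximalRealSubfield L)))
  (w : PlacesOver L v) (hw : IsCMField.complexConj L • w.1 = w.1)

omit [IsCMField L] in
/-- The local form of `Φ₃` at `w` is the literal `antidiag(1, 1, 1)` over `L_w`. [cite: Rogawski1990, §3.5 p. 29] -/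
theorem placeForm_qsForm :
    placeForm (qsForm L) w.1 = Matrix.of fun i j : Fin 3 => if i.val + j.val + 1 = 3 then (1 : w.1.adicCompletion L) else 0 := by
  ext i j
  simp only [placeForm, qsForm, Matrix.map_apply, Matrix.of_apply]
  split_ifs <;> simp

omit [IsCMField L] in
/-- The local form of `Φ₂` at `w` has non-zero determinant. [cite: Rogawski1990, §3.5 p. 29] -/
theorem det_placeForm_antidiagTwo_ne_zero :
    (placeForm (Matrix.of fun i j : Fin 2 => if i.val + j.val + 1 = 2 then (1 : L) else 0) w.1).det ≠ 0 := by
  have h : placeForm (Matrix.of fun i j : Fin 2 => if i.val + j.val + 1 = 2 then (1 : L) else 0) w.1 =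
      Matrix.of fun i j : Fin 2 => if i.val + j.val + 1 = 2 then (1 : w.1.adicCompletion L) else 0 := by
    ext i j
    simp only [placeForm, Matrix.map_apply, Matrix.of_apply]
    split_ifs <;> simp
  rw [h, Matrix.det_fin_two]
  simp

include hw in
set_option maxHeartbeats 1600000 in  -- statement-level `whnf` on the CM carriers
/-- **D3-iv-b «AT MOST ONE Δ-MATCHED CLASS ON THE STRATUM».**  For any transfer factor `T` on the CM carriers (e.g. Δ‴), `γ_H ∈ H_v` ON the stratum
(`|det h₂|_w < |tr h₂|_w²`), and classes `c, c′` of `G = U(Φ₃)(L⁺_v)` with `T.Δ γ_H (out c) ≠ 0` and `T.Δ γ_H (out c′) ≠ 0`: `c = c′`.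
[cite: Rogawski1990, §3.1 p. 19; §3.6 p. 31; §4.3 p. 42] [cite: Kottwitz1986, §7] -/
theorem conjClasses_eq_of_delta_ne_zero_of_on (T : LocalTransferFactor L (qsForm L) v)
    (γH : (cmDatum L 2 (Matrix.of fun i j : Fin 2 => if i.val + j.val + 1 = 2 then (1 : L) else 0)).Local v ×
      (cmDatum L 1 (Matrix.of fun i j : Fin 1 => if i.val + j.val + 1 = 1 then (1 : L) else 0)).Local v)
    (hon : Valued.v ((Pi.evalRingHom (fun w' : PlacesOver L v => w'.1.adicCompletion L) w) ((γH.1.val : GL (Fin 2) (LocalRing L v)) : Matrix (Fin 2) (Fin 2) (LocalRing L v)).det) <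
      Valued.v ((Pi.evalRingHom (fun w' : PlacesOver L v => w'.1.adicCompletion L) w) ((γH.1.val : GL (Fin 2) (LocalRing L v)) : Matrix (Fin 2) (Fin 2) (LocalRing L v)).trace) ^ 2)
    (c c' : ConjClasses ((cmDatum L 3 (qsForm L)).Local v)) (hΔ : T.Δ γH (Quotient.out c) ≠ 0) (hΔ' : T.Δ γH (Quotient.out c') ≠ 0) : c = c' := by
  set ev := Pi.evalRingHom (fun w' : PlacesOver L v => w'.1.adicCompletion L) w with hev
  set σw := galAdicCompletionMap (L := L) (IsCMField.complexConj L) hw with hσw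
  have hσσ : ∀ r, σw (σw r) = r := fun r => galAdicCompletionMap_galAdicCompletionMap_of_smul_eq (IsCMField.complexConj L) w (IsCMField.complexConj_ne_one L) hw r
  have hσv : ∀ x, Valued.v (σw x) = Valued.v x := fun x => valued_galAdicCompletionMap (L := L) (IsCMField.complexConj L) hw x
  set E₃ : (cmDatum L 3 (qsForm L)).Local v ≃ₜ* ↥(unitaryGroupOfForm σw (placeForm (qsForm L) w.1)) :=
    localNonsplitEquiv (IsCMField.complexConj L) (qsForm L) (IsCMField.complexConj_ne_one L) w hw with hE₃
  have hΦ := placeForm_qsForm L v w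
  have hmem : ∀ g : (cmDatum L 3 (qsForm L)).Local v,
      ((E₃ g : ↥(unitaryGroupOfForm σw (placeForm (qsForm L) w.1))) : GL (Fin 3) (w.1.adicCompletion L)) ∈
        unitaryGroup σw (Matrix.of fun i j : Fin 3 => if i.val + j.val + 1 = 3 then (1 : w.1.adicCompletion L) else 0) := by
    intro g
    have h2 := mem_unitaryGroupOfForm_iff.1 (E₃ g).2
    refine Literature.AlgebraicGeometry.ShimuraVarieties.mem_unitaryGroup_iff.2 ?_
    rw [← hΦ]
    exact h2
  -- (1) the common characteristic polynomial `χ_{h₂}(X)·(X − u)` read at `w`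
  set M₂ : Matrix (Fin 2) (Fin 2) (w.1.adicCompletion L) := (((γH.1.val : GL (Fin 2) (LocalRing L v)) : Matrix (Fin 2) (Fin 2) (LocalRing L v)).map ev) with hM₂
  set u : w.1.adicCompletion L := ev (finGammaTwo L v γH) with hu
  have hchar : ∀ c₀ : ConjClasses ((cmDatum L 3 (qsForm L)).Local v), T.Δ γH (Quotient.out c₀) ≠ 0 →
      (((E₃ (Quotient.out c₀) : ↥(unitaryGroupOfForm σw (placeForm (qsForm L) w.1))) : GL (Fin 3) (w.1.adicCompletion L)) :
        Matrix (Fin 3) (Fin 3) (w.1.adicCompletion L)).charpoly = M₂.charpoly * (X - C u) := by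
    intro c₀ h₀
    have h := charpoly_conj_out_eq_of_delta_ne_zero L (qsForm L) v w hw T γH c₀ h₀ 1
    rw [inv_one, mul_one, one_mul] at h
    have hfin : (finCharpolyTwo L v γH).map ev = M₂.charpoly := by
      unfold finCharpolyTwo
      rw [hM₂, Matrix.charpoly_map]
    have h' : ((((endoEmbLocal L v γH).val : GL (Fin 3) (LocalRing L v)) : Matrix (Fin 3) (Fin 3) (LocalRing L v)).map ev).charpoly = M₂.charpoly * (X - C u) := by
      rw [Matrix.charpoly_map, charpoly_endoEmbLocal, Polynomial.map_mul, Polynomial.map_sub, Polynomial.map_X, Polynomial.map_C, hfin]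
    rw [← h']
    exact h
  -- (2) the roots: `|u| = 1`, `|det M₂| = 1`, `l₁ + l₂ = tr`, `l₁ l₂ = det`, `|l₂| < 1 < |l₁|`
  have huv : Valued.v u = 1 := by
    have hm := (localNonsplitEquiv (IsCMField.complexConj L) (Matrix.of fun i j : Fin 1 => if i.val + j.val + 1 = 1 then (1 : L) else 0)
      (IsCMField.complexConj_ne_one L) w hw γH.2).2
    have hcoe := coe_localNonsplitEquiv_eq_map L v w hw (N := 1) (H := Matrix.of fun i j : Fin 1 => if i.val + j.val + 1 = 1 then (1 : L) else 0) γH.2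
    have hJ : (placeForm (Matrix.of fun i j : Fin 1 => if i.val + j.val + 1 = 1 then (1 : L) else 0) w.1) 0 0 ≠ 0 := by
      simp [placeForm, Matrix.map_apply]
    have h1 := F0P3cStCharTSOffStratumG.map_mul_self_eq_one_of_mem_fin_one σw hJ hm
    rw [hcoe, Matrix.map_apply] at h1
    have : u = ev ((γH.2.val.val : Matrix (Fin 1) (Fin 1) (LocalRing L v)) 0 0) := by
      rw [hu]; unfold finGammaTwo; rfl
    rw [this]
    exact F0P3cStCharTSOffStratumG.valuation_eq_one_of_map_mul_self Valued.v σw hσv h1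
  have hdetv : Valued.v M₂.det = 1 := by
    have hm := (localNonsplitEquiv (IsCMField.complexConj L) (Matrix.of fun i j : Fin 2 => if i.val + j.val + 1 = 2 then (1 : L) else 0)
      (IsCMField.complexConj_ne_one L) w hw γH.1).2
    have h1 := det_mul_map_det_eq_one_of_mem_unitaryGroupOfForm σw (det_placeForm_antidiagTwo_ne_zero L v w) hm
    have hcoe := coe_localNonsplitEquiv_eq_map L v w hw (N := 2) (H := Matrix.of fun i j : Fin 2 => if i.val + j.val + 1 = 2 then (1 : L) else 0) γH.1
    rw [hcoe, ← hM₂, mul_comm] at h1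
    exact F0P3cStCharTSOffStratumG.valuation_eq_one_of_map_mul_self Valued.v σw hσv h1
  have htr0 : M₂.trace ≠ 0 := fun h0 => by
    have : Valued.v M₂.det < Valued.v M₂.trace ^ 2 := by
      have htrace : M₂.trace = ev ((γH.1.val : GL (Fin 2) (LocalRing L v)) : Matrix (Fin 2) (Fin 2) (LocalRing L v)).trace := by
        rw [hM₂, Matrix.trace, Matrix.trace, map_sum]; rfl
      have hdet : M₂.det = ev ((γH.1.val : GL (Fin 2) (LocalRing L v)) : Matrix (Fin 2) (Fin 2) (LocalRing L v)).det := by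
        rw [hM₂, ← RingHom.mapMatrix_apply, ← RingHom.map_det]
      rw [htrace, hdet]; exact hon
    rw [h0, Valuation.map_zero, zero_pow two_ne_zero] at this
    exact not_lt_of_ge zero_le this
  have hon' : Valued.v M₂.det < Valued.v M₂.trace ^ 2 := by
    have htrace : M₂.trace = ev ((γH.1.val : GL (Fin 2) (LocalRing L v)) : Matrix (Fin 2) (Fin 2) (LocalRing L v)).trace := by
      rw [hM₂, Matrix.trace, Matrix.trace, map_sum]; rfl
    have hdet : M₂.det = ev ((γH.1.val : GL (Fin 2) (LocalRing L v)) : Matrix (Fin 2) (Fin 2) (LocalRing L v)).det := by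
      rw [hM₂, ← RingHom.mapMatrix_apply, ← RingHom.map_det]
    rw [htrace, hdet]; exact hon
  obtain ⟨l₁, l₂, hsum, hprod, hv1, hv2⟩ := F0P3cStCharTSRankOneHyp.exists_roots_of_valued_lt_sq w.1 M₂.trace M₂.det htr0 hon'
  have hl : Valued.v l₂ < 1 ∧ 1 < Valued.v l₁ := by
    refine lt_one_lt_of_mul_eq_one_of_lt Valued.v ?_ (by rw [hv1]; exact hv2)
    rw [← Valuation.map_mul, hprod, hdetv]
  -- (3) the diagonal `d = (l₁, u, l₂)`, the product formula, injectivity and the six norms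
  set d : Fin 3 → w.1.adicCompletion L := ![l₁, u, l₂] with hd
  have hprodX : M₂.charpoly * (X - C u) = ∏ i, (X - C (d i)) := by
    rw [Matrix.charpoly_fin_two, Fin.prod_univ_three, hd]
    simp only [Matrix.cons_val_zero, Matrix.cons_val_one, Matrix.cons_val_two, Matrix.head_cons, Matrix.tail_cons]
    rw [← hsum, ← hprod, map_add, map_mul]
    ring
  have hdinj : Function.Injective d := injective_vecCons_three Valued.v huv hl.1 hl.2
  have hd0 : Valued.v (d 0) = Valued.v l₁ := by simp [hd]
  have hd1 : Valued.v (d 1) = 1 := by simp [hd, huv]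
  have hd2 : Valued.v (d 2) = Valued.v l₂ := by simp [hd]
  have hne : ∀ {a b : w.1.adicCompletion L}, Valued.v a * Valued.v b ≠ 1 → σw a * b ≠ 1 := fun h => map_mul_ne_one_of_valuation Valued.v σw hσv h
  have hgt1 : ∀ {x y : WithZero (Multiplicative ℤ)}, 1 < x → 1 ≤ y → x * y ≠ 1 := fun {x y} hx hy h => by
    have : (1 : WithZero (Multiplicative ℤ)) < x * y := by
      calc (1 : WithZero (Multiplicative ℤ)) = 1 * 1 := (one_mul _).symm
        _ < x * 1 := mul_lt_mul_of_pos_right hx zero_lt_one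
        _ ≤ x * y := mul_le_mul' le_rfl hy
    rw [h] at this; exact lt_irrefl _ this
  have hlt1 : ∀ {x y : WithZero (Multiplicative ℤ)}, x < 1 → y ≤ 1 → x * y ≠ 1 := fun {x y} hx hy h => by
    have : x * y < 1 := by
      calc x * y ≤ x * 1 := mul_le_mul' le_rfl hy
        _ = x := mul_one _
        _ < 1 := hx
    rw [h] at this; exact lt_irrefl _ this
  have h00 : σw (d 0) * d 0 ≠ 1 := hne (by rw [hd0]; exact hgt1 hl.2 hl.2.le)
  have h01 : σw (d 0) * d 1 ≠ 1 := hne (by rw [hd0, hd1]; exact hgt1 hl.2 le_rfl)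
  have h10 : σw (d 1) * d 0 ≠ 1 := hne (by rw [hd0, hd1, mul_comm]; exact hgt1 hl.2 le_rfl)
  have h12 : σw (d 1) * d 2 ≠ 1 := hne (by rw [hd1, hd2, mul_comm]; exact hlt1 hl.1 le_rfl)
  have h21 : σw (d 2) * d 1 ≠ 1 := hne (by rw [hd1, hd2]; exact hlt1 hl.1 le_rfl)
  have h22 : σw (d 2) * d 2 ≠ 1 := hne (by rw [hd2]; exact hlt1 hl.1 hl.1.le)
  -- (4) the two model elements are conjugate in `U(Φ₃)(L_w)`; pull back through `E₃`
  set γ₁ : ↥(unitaryGroup σw (Matrix.of fun i j : Fin 3 => if i.val + j.val + 1 = 3 then (1 : w.1.adicCompletion L) else 0)) := ⟨_, hmem (Quotient.out c)⟩ with hγ₁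
  set γ₂ : ↥(unitaryGroup σw (Matrix.of fun i j : Fin 3 => if i.val + j.val + 1 = 3 then (1 : w.1.adicCompletion L) else 0)) := ⟨_, hmem (Quotient.out c')⟩ with hγ₂
  have hconj' : IsConj γ₁ γ₂ :=
    isConj_of_charpoly_eq_prod_of_splitPattern σw hσσ hdinj ((hchar c hΔ).trans hprodX) ((hchar c' hΔ').trans hprodX) h00 h01 h10 h12 h21 h22
  obtain ⟨k, hk⟩ := isConj_iff.1 hconj'
  have hkmem : ((k : ↥(unitaryGroup σw (Matrix.of fun i j : Fin 3 => if i.val + j.val + 1 = 3 then (1 : w.1.adicCompletion L) else 0))) : GL (Fin 3) (w.1.adicCompletion L)) ∈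
      unitaryGroupOfForm σw (placeForm (qsForm L) w.1) := by
    have h2 := Literature.AlgebraicGeometry.ShimuraVarieties.mem_unitaryGroup_iff.1 k.2
    refine mem_unitaryGroupOfForm_iff.2 ?_
    rw [hΦ]
    exact h2
  set k' : ↥(unitaryGroupOfForm σw (placeForm (qsForm L) w.1)) := ⟨_, hkmem⟩ with hk'
  have hkE : k' * E₃ (Quotient.out c) * k'⁻¹ = E₃ (Quotient.out c') := by
    apply Subtype.ext
    have := congrArg Subtype.val hk
    simpa [hk'] using this
  have hconj : IsConj (Quotient.out c) (Quotient.out c') := by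
    refine isConj_iff.2 ⟨E₃.symm k', E₃.injective ?_⟩
    rw [map_mul, map_mul, map_inv, ContinuousMulEquiv.apply_symm_apply]
    exact hkE
  have h1 : ConjClasses.mk (Quotient.out c) = c := Quotient.out_eq c
  have h2 : ConjClasses.mk (Quotient.out c') = c' := Quotient.out_eq c'
  rw [← h1, ← h2]
  exact ConjClasses.mk_eq_mk_iff_isConj.2 hconj

include hw in
set_option maxHeartbeats 1600000 in  -- statement-level `whnf` on the CM carriers
/-- **D3-iv-b «Σ_c Δ(γ_H, c) Φ(c, f) HAS ONE TERM ON THE STRATUM».**  For every orbital measure family `mG`, every `f`, `γ_H` ON the stratum and a class `c₀` with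
`T.Δ γ_H (out c₀) ≠ 0`: `∑ᶠ c, T.Δ γ_H (out c) · classOrbitalIntegral mG f c = T.Δ γ_H (out c₀) · classOrbitalIntegral mG f c₀`. [cite: Rogawski1990, §4.3 (4.3.1) p. 43; §3.6 p. 31] -/
theorem finsum_delta_mul_classOrbitalIntegral_eq_of_on
    [∀ γ : (cmDatum L 3 (qsForm L)).Local v, MeasurableSpace ((cmDatum L 3 (qsForm L)).Local v ⧸ Subgroup.centralizer ({γ} : Set ((cmDatum L 3 (qsForm L)).Local v)))]
    (T : LocalTransferFactor L (qsForm L) v) (mG : OrbitalMeasureFamily ((cmDatum L 3 (qsForm L)).Local v)) (f : (cmDatum L 3 (qsForm L)).Local v → ℂ)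
    (γH : (cmDatum L 2 (Matrix.of fun i j : Fin 2 => if i.val + j.val + 1 = 2 then (1 : L) else 0)).Local v ×
      (cmDatum L 1 (Matrix.of fun i j : Fin 1 => if i.val + j.val + 1 = 1 then (1 : L) else 0)).Local v)
    (hon : Valued.v ((Pi.evalRingHom (fun w' : PlacesOver L v => w'.1.adicCompletion L) w) ((γH.1.val : GL (Fin 2) (LocalRing L v)) : Matrix (Fin 2) (Fin 2) (LocalRing L v)).det) <
      Valued.v ((Pi.evalRingHom (fun w' : PlacesOver L v => w'.1.adicCompletion L) w) ((γH.1.val : GL (Fin 2) (LocalRing L v)) : Matrix (Fin 2) (Fin 2) (LocalRing L v)).trace) ^ 2)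
    (c₀ : ConjClasses ((cmDatum L 3 (qsForm L)).Local v)) (hΔ : T.Δ γH (Quotient.out c₀) ≠ 0) :
    ∑ᶠ c : ConjClasses ((cmDatum L 3 (qsForm L)).Local v), T.Δ γH (Quotient.out c) * classOrbitalIntegral mG f c =
      T.Δ γH (Quotient.out c₀) * classOrbitalIntegral mG f c₀ := by
  refine finsum_eq_single _ c₀ (fun c hc => ?_)
  have hz : T.Δ γH (Quotient.out c) = 0 := by
    by_contra hne
    exact hc (conjClasses_eq_of_delta_ne_zero_of_on L v w hw T γH hon c c₀ hne hΔ)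
  rw [hz, zero_mul]

end CM

end Summit.HodgeConjecture.HodgeConjecture.Cruxes.H413.F0P3cStCharTSOnStratumG
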